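import Summits.QuantumFields.YangMills.Theorems.ForcedResponseSkewnessFemtoEngineDefs
import Summits.QuantumFields.YangMills.Theorems.ForcedResponseSkewnessResponseLocalisationCentredOscCover
import Summits.QuantumFields.YangMills.Theorems.ForcedResponseSkewnessRunningCouplingCeilingFemtoLogCover
import Summits.QuantumFields.YangMills.Theorems.BalabanLadderNTBoundaryLawOscillation
import Summits.QuantumFields.YangMills.Theorems.LangevinControlUVOSLegsAtWeakCouplingCFblOfFbl6
import HarnessLib

/-!
# Route `ForcedResponseSkewness`: the femto engine interface may be delivered on the ENGINE'S OWN RADII (a covering set of cube sizes)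

Helper file of the lead `ym-line-frs-p1` (g6), `--supports stmt-QuantumFields-26871`.  The route's physics debt outside the residual is
`FemtoEngineSigR = FBL6OscSigR ∧ CentredOscLawSigR ∧ CentredFemtoLogSigR` (`Theorems/ForcedResponseSkewnessFemtoEngineDefs.lean`; certificate
`FemtoEngine.nt_of_femtoEngine`, `Theorems/ForcedResponseSkewnessFemtoEngineInterface.lean`) — three laws at the centre of the centred femto
cubes `[-N,N]⁴` along a pinned unit, for EVERY radius `N`.  A multi-scale expansion works on its own cube sizes `N ∈ S` (e.g. `L^k·M`).  The
three covering-radii transports exist separately in the tree — spine `BoundaryLaw.osc_le_of_cover` (one-point oscillation, antitone under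
nesting), the lead's `CentredOsc.centredOscLaw_of_cover` (p621436) and width seat frs-p2's `CentredLog.centredFemtoLog_of_cover` (both: one
law-of-total-covariance step through the cover cube, second order in `FBL`).  This file assembles them into ONE statement:

* `fbl6Osc_of_cover` — E0′ on a set `S` covering every radius `D ≥ D₀` up to a factor `θ` (`∃ N ∈ S, N+1 ≤ D ≤ θ(N+1)`) gives `FBL6Osc G r a`
  (constant `θ⁴C₁`, threshold radius `D₀`);
* `fbl6OscSigR_of_cover`, `centredOscLawSigR_of_cover`, `centredFemtoLogSigR_of_cover` — the pinned forms (the cover set may depend on `G, r, a`;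
  the covariance laws take the frozen-boundary law `FBLPinnedSigR`, itself a consequence of the E0′ conjunct);
* `femtoEngineSigR_of_cover` — all three laws on covering radii along the pinned unit ⇒ `FemtoEngineSigR`.

Honest label: unconditional bookkeeping inside a CONDITIONAL rung line (leaf R2a `BalabanLadder.NT`); none of the three laws, the cruxes
26871/24275, the residual 24873, `NT` or the Yang–Mills mass gap is proved here.
-/

set_option autoImplicit false

noncomputable section

namespace Summit.QuantumFields.YangMills.Cruxes.ResponseLocalisation.FemtoEngine

open MeasureTheory Filter Topology
open Literature.MathematicalPhysics.QuantumFieldTheory Literature.MathematicalPhysics.QuantumLattice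
open Literature.Probability.LatticeModels
open Summit.QuantumFields.YangMills.Cruxes.OSLegsFromFemtoAndGap.DlrCollarTransfer
open Summit.QuantumFields.YangMills.Cruxes.ResponseLocalisation.Birth
open Summit.QuantumFields.YangMills.Cruxes.ResponseLocalisation.CentredOsc (centredOscLaw_of_cover)
open Summit.QuantumFields.YangMills.Cruxes.RunningCouplingCeiling.Pointwise (CentredFemtoLogSigR)
open Summit.QuantumFields.YangMills.Cruxes.RunningCouplingCeiling.CentredLog (centredFemtoLog_of_cover)
open Summit.QuantumFields.YangMills.Cruxes.NT.BoundaryLaw (osc_le_of_cover admissible_of_le fbl6_of_oscillation)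

/-! ## E0′ on covering radii -/

section Unit

variable (G : Type) [Group G] [TopologicalSpace G] [IsTopologicalGroup G] [CompactSpace G]
  [MeasurableSpace G] [BorelSpace G] (r : LatticeRep G)

/-- **E0′ on a covering set of radii suffices.**  If the two-exterior oscillation of the central kernel mean of the plaquette field
`plane (0,1) 0` on the centred femto cubes `[-N,N]⁴`, `N ∈ S`, is at most `C₁/(N+1)⁴`, and `S` covers every radius `D ≥ D₀` up to the
factor `θ` (`∃ N ∈ S, N+1 ≤ D ≤ θ(N+1)`), then `FBL6Osc G r a` holds (all radii `R ≥ D₀`, constant `θ⁴C₁`): the oscillation over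
exteriors is antitone under nesting of cubes (spine `BoundaryLaw.osc_le_of_cover`). [folklore] -/
theorem fbl6Osc_of_cover (a : ℝ → ℝ) (ha : ∀ β, 0 < a β) (S : Set ℕ) (θ : ℝ) (D₀ : ℕ)
    (hcover : ∀ D : ℕ, D₀ ≤ D → ∃ N ∈ S, N + 1 ≤ D ∧ (D : ℝ) ≤ θ * ((N : ℝ) + 1))
    (h : ∃ (C₁ β₁ ℓ₁ : ℝ), 0 < ℓ₁ ∧ ∀ β : ℝ, β₁ ≤ β → ∀ N ∈ S,
      ((2 * N + 1 : ℕ) : ℝ) * a β ≤ ℓ₁ → ∀ η η' : LGConfig 4 G,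
        |kerE G r β (fun _ => -(N : ℤ)) (2 * N + 1) η (plane G r (0, 1) 0) -
          kerE G r β (fun _ => -(N : ℤ)) (2 * N + 1) η' (plane G r (0, 1) 0)| ≤ C₁ / ((N : ℝ) + 1) ^ 4) :
    FBL6Osc G r a := by
  obtain ⟨C₁, β₁, ℓ₁, hℓ₁, H⟩ := h
  obtain ⟨M, hM⟩ := exists_abs_plane_le (G := G) r
  refine ⟨D₀, θ ^ 4 * C₁, β₁, ℓ₁, hℓ₁, fun β hβ R hDR hRa η η' => ?_⟩
  obtain ⟨N, hNS, hN1, hθN⟩ := hcover (R + 1) (by omega)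
  have hle : N ≤ R := by omega
  have hθ' : (R : ℝ) + 1 ≤ θ * ((N : ℝ) + 1) := by exact_mod_cast hθN
  exact osc_le_of_cover G r β (continuous_plane r (0, 1) 0) (hM (0, 1) 0) hle hθ'
    (H β hβ N hNS (admissible_of_le (ha β) hle hRa)) η η'

end Unit

/-! ## Pinned forms -/

/-- **The E0′ stub from its covering-radii form** (the cover set, factor and threshold may depend on `G, r, a`). [folklore] -/
theorem fbl6OscSigR_of_cover
    (h : ∀ (G : Type) [Group G] [TopologicalSpace G] [IsTopologicalGroup G] [CompactSpace G],
      IsCompactSimpleLieGroup G →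
      letI : MeasurableSpace G := borel G
      haveI : BorelSpace G := ⟨rfl⟩
      ∀ (r : LatticeRep G) (a : ℝ → ℝ), (∀ β, 0 < a β) → Filter.Tendsto a Filter.atTop (nhds 0) →
        (∃ (v₀ : SchwartzMap (EuclideanSpace ℝ (Fin 4)) ℝ) (ε β₅ Λ₅ : ℝ), HasCompactSupport v₀ ∧
          tsupport v₀ ⊆ {y : EuclideanSpace ℝ (Fin 4) | 0 < y 0} ∧ 0 < ε ∧
          ∀ β : ℝ, β₅ ≤ β → ∀ L : ℕ, Λ₅ ≤ a β * L → ε ≤ Q2 G r β L (a β) (thetaTest 4 v₀) v₀) →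
        ∃ (S : Set ℕ) (θ : ℝ) (D₀ : ℕ),
          (∀ D : ℕ, D₀ ≤ D → ∃ N ∈ S, N + 1 ≤ D ∧ (D : ℝ) ≤ θ * ((N : ℝ) + 1)) ∧
          ∃ (C₁ β₁ ℓ₁ : ℝ), 0 < ℓ₁ ∧ ∀ β : ℝ, β₁ ≤ β → ∀ N ∈ S,
            ((2 * N + 1 : ℕ) : ℝ) * a β ≤ ℓ₁ → ∀ η η' : LGConfig 4 G,
              |kerE G r β (fun _ => -(N : ℤ)) (2 * N + 1) η (plane G r (0, 1) 0) -
                kerE G r β (fun _ => -(N : ℤ)) (2 * N + 1) η' (plane G r (0, 1) 0)| ≤ C₁ / ((N : ℝ) + 1) ^ 4) :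
    FBL6OscSigR := by
  intro G _ _ _ _ hG
  letI : MeasurableSpace G := borel G
  haveI : BorelSpace G := ⟨rfl⟩
  intro r a hpos hlim hpin
  obtain ⟨S, θ, D₀, hcover, hS⟩ := h G hG r a hpos hlim hpin
  exact fbl6Osc_of_cover G r a hpos S θ D₀ hcover hS

/-- **The centred oscillation law (AF stub of 26871) from its covering-radii form**, given the pinned frozen-boundary law (the lead's
`CentredOsc.centredOscLaw_of_cover`, p621436, along the pinned unit). [folklore] -/
theorem centredOscLawSigR_of_cover (hFBL : FBLPinnedSigR)
    (h : ∀ (G : Type) [Group G] [TopologicalSpace G] [IsTopologicalGroup G] [CompactSpace G],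
      IsCompactSimpleLieGroup G →
      letI : MeasurableSpace G := borel G
      haveI : BorelSpace G := ⟨rfl⟩
      ∀ (r : LatticeRep G) (a : ℝ → ℝ), (∀ β, 0 < a β) → Filter.Tendsto a Filter.atTop (nhds 0) →
        (∃ (v₀ : SchwartzMap (EuclideanSpace ℝ (Fin 4)) ℝ) (ε β₅ Λ₅ : ℝ), HasCompactSupport v₀ ∧
          tsupport v₀ ⊆ {y : EuclideanSpace ℝ (Fin 4) | 0 < y 0} ∧ 0 < ε ∧
          ∀ β : ℝ, β₅ ≤ β → ∀ L : ℕ, Λ₅ ≤ a β * L → ε ≤ Q2 G r β L (a β) (thetaTest 4 v₀) v₀) →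
        ∃ (S : Set ℕ) (θ : ℝ) (D₀ : ℕ), 1 ≤ θ ∧
          (∀ D : ℕ, D₀ ≤ D → ∃ N ∈ S, N + 1 ≤ D ∧ (D : ℝ) ≤ θ * ((N : ℝ) + 1)) ∧
          ∃ ℓ₂ : ℝ, 0 < ℓ₂ ∧ ∀ κ : ℝ, 0 < κ → ∀ d₀ : ℝ, 0 < d₀ → d₀ ≤ ℓ₂ →
            ∃ R : ℝ, 0 < R ∧ R ≤ d₀ ∧ ∃ β₂ : ℝ, ∀ β : ℝ, β₂ ≤ β → ∀ N ∈ S, ((2 * N + 1 : ℕ) : ℝ) * a β ≤ ℓ₂ →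
              R / a β + 2 ≤ (N : ℝ) + 1 → d₀ ≤ a β * ((N : ℝ) + 1) →
              ∀ (η η' : LGConfig 4 G) (B : Finset (Fin 4 → ℤ)),
                (∀ w : Fin 4 → ℤ, a β * ‖siteToE w‖ < R → w ∈ B) →
                ∀ φ : ℝ → ℝ, (∀ t, |φ t| ≤ 1) → (∀ t, R ≤ t → φ t = 0) →
                  |∑ w ∈ B, φ (a β * ‖siteToE w‖) *
                      (kerCov G r β (fun _ => -(N : ℤ)) (2 * N + 1) η (dens G r w) (dens G r 0) -
                        kerCov G r β (fun _ => -(N : ℤ)) (2 * N + 1) η' (dens G r w) (dens G r 0))| ≤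
                    κ / ((N : ℝ) + 1) ^ 4) :
    CentredOscLawSigR := by
  intro G _ _ _ _ hG
  letI : MeasurableSpace G := borel G
  haveI : BorelSpace G := ⟨rfl⟩
  intro r a hpos hlim hpin
  obtain ⟨S, θ, D₀, hθ, hcover, hosc⟩ := h G hG r a hpos hlim hpin
  exact centredOscLaw_of_cover G r a hpos hlim (hFBL G hG r a hpos hlim hpin) S θ hθ D₀ hcover hosc

/-- **The centred femto log ceiling (AF stub of 24275) from its covering-radii form**, given the pinned frozen-boundary law (width seat
frs-p2's `CentredLog.centredFemtoLog_of_cover` along the pinned unit). [folklore] -/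
theorem centredFemtoLogSigR_of_cover (hFBL : FBLPinnedSigR)
    (h : ∀ (G : Type) [Group G] [TopologicalSpace G] [IsTopologicalGroup G] [CompactSpace G],
      IsCompactSimpleLieGroup G →
      letI : MeasurableSpace G := borel G
      haveI : BorelSpace G := ⟨rfl⟩
      ∀ (r : LatticeRep G) (a : ℝ → ℝ), (∀ β, 0 < a β) → Filter.Tendsto a Filter.atTop (nhds 0) →
        (∃ (v₀ : SchwartzMap (EuclideanSpace ℝ (Fin 4)) ℝ) (ε β₅ Λ₅ : ℝ), HasCompactSupport v₀ ∧
          tsupport v₀ ⊆ {y : EuclideanSpace ℝ (Fin 4) | 0 < y 0} ∧ 0 < ε ∧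
          ∀ β : ℝ, β₅ ≤ β → ∀ L : ℕ, Λ₅ ≤ a β * L → ε ≤ Q2 G r β L (a β) (thetaTest 4 v₀) v₀) →
        ∃ (S : Set ℕ) (θ : ℝ) (D₀ : ℕ), 1 ≤ θ ∧
          (∀ D : ℕ, D₀ ≤ D → ∃ N ∈ S, N + 1 ≤ D ∧ (D : ℝ) ≤ θ * ((N : ℝ) + 1)) ∧
          ∃ (ℓ₂ C₂ β₂ : ℝ) (K : ℝ → ℝ) (n₀ : ℕ), 0 < ℓ₂ ∧ (∀ s, 1 ≤ K s) ∧
            Filter.Tendsto (fun s : ℝ => s * K s) (nhdsWithin 0 (Set.Ioi 0)) (nhds 0) ∧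
            ∀ β : ℝ, β₂ ≤ β → ∀ N ∈ S, ((2 * N + 1 : ℕ) : ℝ) * a β ≤ ℓ₂ →
              ∀ (η : LGConfig 4 G) (y : Fin 4 → ℤ), (n₀ : ℝ) ≤ ‖siteToE y‖ →
                (K (‖siteToE y‖ * a β) + 1) * ‖siteToE y‖ ≤ (N : ℝ) + 1 →
                  ‖siteToE y‖ ^ 8 * |kerCov G r β (fun _ => -(N : ℤ)) (2 * N + 1) η (dens G r 0) (dens G r y)| ≤
                    C₂ / Real.log (1 / (‖siteToE y‖ * a β)) ^ 2) :
    CentredFemtoLogSigR := by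
  intro G _ _ _ _ hG
  letI : MeasurableSpace G := borel G
  haveI : BorelSpace G := ⟨rfl⟩
  intro r a hpos hlim hpin
  obtain ⟨S, θ, D₀, hθ, hcover, hlog⟩ := h G hG r a hpos hlim hpin
  exact centredFemtoLog_of_cover G r a hpos (hFBL G hG r a hpos hlim hpin) S θ hθ D₀ hcover hlog

/-! ## The whole interface on covering radii -/

/-- **The femto engine interface from its covering-radii form.**  Along every pinned unit let a set of radii `S` (with a factor `θ ≥ 1`
and a threshold `D₀`, all allowed to depend on `G, r, a`) cover every radius, and let the three engine-form laws hold for the centred femto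
cubes of radii in `S` only: E0′ (two-exterior oscillation of the central plaquette mean `≤ C₁/(N+1)⁴`), E-sym (signed radial near-pair
covariance sums, two exteriors, `≤ κ/(N+1)⁴`) and E-log (the log two-point ceiling).  Then `FemtoEngineSigR` holds — the frozen-boundary
law needed by the two covariance transports is supplied by the E0′ conjunct itself (`fbl6Osc_of_cover`, spine `fbl6_of_oscillation`,
tree `fbl_of_fbl6`). [folklore] -/
theorem femtoEngineSigR_of_cover
    (h : ∀ (G : Type) [Group G] [TopologicalSpace G] [IsTopologicalGroup G] [CompactSpace G],
      IsCompactSimpleLieGroup G →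
      letI : MeasurableSpace G := borel G
      haveI : BorelSpace G := ⟨rfl⟩
      ∀ (r : LatticeRep G) (a : ℝ → ℝ), (∀ β, 0 < a β) → Filter.Tendsto a Filter.atTop (nhds 0) →
        (∃ (v₀ : SchwartzMap (EuclideanSpace ℝ (Fin 4)) ℝ) (ε β₅ Λ₅ : ℝ), HasCompactSupport v₀ ∧
          tsupport v₀ ⊆ {y : EuclideanSpace ℝ (Fin 4) | 0 < y 0} ∧ 0 < ε ∧
          ∀ β : ℝ, β₅ ≤ β → ∀ L : ℕ, Λ₅ ≤ a β * L → ε ≤ Q2 G r β L (a β) (thetaTest 4 v₀) v₀) →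
        ∃ (S : Set ℕ) (θ : ℝ) (D₀ : ℕ), 1 ≤ θ ∧
          (∀ D : ℕ, D₀ ≤ D → ∃ N ∈ S, N + 1 ≤ D ∧ (D : ℝ) ≤ θ * ((N : ℝ) + 1)) ∧
          (∃ (C₁ β₁ ℓ₁ : ℝ), 0 < ℓ₁ ∧ ∀ β : ℝ, β₁ ≤ β → ∀ N ∈ S,
            ((2 * N + 1 : ℕ) : ℝ) * a β ≤ ℓ₁ → ∀ η η' : LGConfig 4 G,
              |kerE G r β (fun _ => -(N : ℤ)) (2 * N + 1) η (plane G r (0, 1) 0) -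
                kerE G r β (fun _ => -(N : ℤ)) (2 * N + 1) η' (plane G r (0, 1) 0)| ≤ C₁ / ((N : ℝ) + 1) ^ 4) ∧
          (∃ ℓ₂ : ℝ, 0 < ℓ₂ ∧ ∀ κ : ℝ, 0 < κ → ∀ d₀ : ℝ, 0 < d₀ → d₀ ≤ ℓ₂ →
            ∃ R : ℝ, 0 < R ∧ R ≤ d₀ ∧ ∃ β₂ : ℝ, ∀ β : ℝ, β₂ ≤ β → ∀ N ∈ S, ((2 * N + 1 : ℕ) : ℝ) * a β ≤ ℓ₂ →
              R / a β + 2 ≤ (N : ℝ) + 1 → d₀ ≤ a β * ((N : ℝ) + 1) →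
              ∀ (η η' : LGConfig 4 G) (B : Finset (Fin 4 → ℤ)),
                (∀ w : Fin 4 → ℤ, a β * ‖siteToE w‖ < R → w ∈ B) →
                ∀ φ : ℝ → ℝ, (∀ t, |φ t| ≤ 1) → (∀ t, R ≤ t → φ t = 0) →
                  |∑ w ∈ B, φ (a β * ‖siteToE w‖) *
                      (kerCov G r β (fun _ => -(N : ℤ)) (2 * N + 1) η (dens G r w) (dens G r 0) -
                        kerCov G r β (fun _ => -(N : ℤ)) (2 * N + 1) η' (dens G r w) (dens G r 0))| ≤
                    κ / ((N : ℝ) + 1) ^ 4) ∧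
          (∃ (ℓ₂ C₂ β₂ : ℝ) (K : ℝ → ℝ) (n₀ : ℕ), 0 < ℓ₂ ∧ (∀ s, 1 ≤ K s) ∧
            Filter.Tendsto (fun s : ℝ => s * K s) (nhdsWithin 0 (Set.Ioi 0)) (nhds 0) ∧
            ∀ β : ℝ, β₂ ≤ β → ∀ N ∈ S, ((2 * N + 1 : ℕ) : ℝ) * a β ≤ ℓ₂ →
              ∀ (η : LGConfig 4 G) (y : Fin 4 → ℤ), (n₀ : ℝ) ≤ ‖siteToE y‖ →
                (K (‖siteToE y‖ * a β) + 1) * ‖siteToE y‖ ≤ (N : ℝ) + 1 →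
                  ‖siteToE y‖ ^ 8 * |kerCov G r β (fun _ => -(N : ℤ)) (2 * N + 1) η (dens G r 0) (dens G r y)| ≤
                    C₂ / Real.log (1 / (‖siteToE y‖ * a β)) ^ 2)) :
    FemtoEngineSigR := by
  -- E0′ along every pinned unit, hence the frozen-boundary law `FBL` there
  have hOsc : FBL6OscSigR := by
    refine fbl6OscSigR_of_cover ?_
    intro G _ _ _ _ hG
    letI : MeasurableSpace G := borel G
    haveI : BorelSpace G := ⟨rfl⟩
    intro r a hpos hlim hpin
    obtain ⟨S, θ, D₀, -, hcover, hE0, -, -⟩ := h G hG r a hpos hlim hpin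
    exact ⟨S, θ, D₀, hcover, hE0⟩
  have hFBL : FBLPinnedSigR := by
    intro G _ _ _ _ hG
    letI : MeasurableSpace G := borel G
    haveI : BorelSpace G := ⟨rfl⟩
    intro r a hpos hlim hpin
    obtain ⟨D, C₁, β₁, ℓ₁, hℓ₁, H⟩ := hOsc G hG r a hpos hlim hpin
    exact fbl_of_fbl6 r a (fbl6_of_oscillation G r a hpos D ⟨C₁, β₁, ℓ₁, hℓ₁, H⟩)
  refine ⟨hOsc, centredOscLawSigR_of_cover hFBL ?_, centredFemtoLogSigR_of_cover hFBL ?_⟩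
  · intro G _ _ _ _ hG
    letI : MeasurableSpace G := borel G
    haveI : BorelSpace G := ⟨rfl⟩
    intro r a hpos hlim hpin
    obtain ⟨S, θ, D₀, hθ, hcover, -, hsym, -⟩ := h G hG r a hpos hlim hpin
    exact ⟨S, θ, D₀, hθ, hcover, hsym⟩
  · intro G _ _ _ _ hG
    letI : MeasurableSpace G := borel G
    haveI : BorelSpace G := ⟨rfl⟩
    intro r a hpos hlim hpin
    obtain ⟨S, θ, D₀, hθ, hcover, -, -, hlog⟩ := h G hG r a hpos hlim hpin
    exact ⟨S, θ, D₀, hθ, hcover, hlog⟩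

end Summit.QuantumFields.YangMills.Cruxes.ResponseLocalisation.FemtoEngine

end
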